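import Summits.HodgeConjecture.HodgeConjecture.Theorems.R90S5APacketMultOfCoreLaws   -- ★ p861936 `aPacketMult_of_coreLaws` (Thm 13.3.7 for `Π(ξ)` from the SEVEN laws its ★ proof uses)
import HarnessLib

/-!
# R90-TF · S5 «Ch. 13.3 multiplicity ∕ rigidity» — §13.10 ¶3 membership half FROM THE SEVEN CORE LAWS: in the germ of `t(I_{ξ̃′})`, `m(π) ≠ 0 ⇒ π ∈ Π(ξ)`
# (the core-laws twin of ★ `mem_aPacket_of_m_ne_zero_of_laws`, p861463; LEAD #22 J-D2-3 «no 15-law costume» — what S10 FILE F's `coreLaws_of_sections` feeds)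

Cell `hodgecm-mathlib`, crux H413 (`stmt-HodgeConjecture-24833`), route of record `HCCMUnconditional`; programme R90-TF (brief `director/R90-BRIEF.v2.md`
1f40d54518340a35), section S5 = Ch. 13.3 (base `R90-C133`), seat R90-C133-p01 (g0); R90-C133-plan (g0) DEAL #18 (16:33:49Z) «`mem_aPacket_of_m_ne_zero_of_coreLaws` 10-liner next to
★ p861936 if that file lacks it» (it does: it has `aPacketMult_of_coreLaws`, `…_of_pins`, `nComponent_routesToAPacket_of_coreLaws`, `aPacketMult_of_laws_of_coreLaws` only) and
DEAL #18c (the D pay-edition draft consumes THIS as the `hMemLaw` feed of ★ `xiRigiditySharpQsAt_of_memLaw_of_pins`, p861842).  Lane `--supports stmt-HodgeConjecture-24833 --as helper`;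
ONE theorem, no definition, no instance, no notation, no `sorry`; dictionary level only.
HONEST LABEL: HC_CM is proved only modulo the 7 printed citations (2 remaining named inputs: hLiu418 = stmt-HodgeConjecture-24832, h413 = stmt-HodgeConjecture-24833)
until rung 0 closes; this file proves nothing about them — a class-K deduction inside the ★ dictionary with hypotheses = SEVEN printed relations on a posited datum `𝔨`
(`MainEquality` [Thm 10.3.1 (a)], `MatchTensor` [§4.5], `GermExpansion` [Props 13.5.1, 13.6.1–2], `Separation` [§13.7], `CoeffEndoscopic` [13.7 (3) + L. 13.6.3], `APacketLift`
[Prop 13.2.2 (d)], `LinIndepGerm` [Prop 13.8.1]); junk-satisfiable ALONE (kernel cert `CertJunkTwistedComparison` bdd77acf197a3ad2) — content enters at S10 FILE F's concrete datum.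

[cite: Rogawski1990, §13.10 pp. 230–231; Thm 13.3.7 p. 203; §13.8 Prop. 13.8.1 p. 213, (13.8.3) p. 218, (13.8.8) p. 227] [cite: Marshall2014, §3.4]
-/

set_option autoImplicit false
-- the mandated namespace repeats the single-problem summit's segment (`HodgeConjecture.HodgeConjecture`)
set_option linter.dupNamespace false

noncomputable section

open Literature.NumberTheory.Rogawski1990

namespace Summit.HodgeConjecture.HodgeConjecture.R90.S5

/-- **§13.10 ¶3, membership half, from the SEVEN core laws**: for a twisted-comparison datum `𝔨` satisfying `MainEquality, MatchTensor, GermExpansion, Separation,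
CoeffEndoscopic, APacketLift, LinIndepGerm` and a ONE-DIMENSIONAL `ξ ∈ Π(H)` not of the form `ρ(θ)`, there is an A-packet `P = Π(ξ)` of the datum with `ξ ↦ P` such that
every discrete `π` of `G` in the germ of `t(I_{ξ̃′})` with `m(π) ≠ 0` is a MEMBER of `P` (★ `aPacketMult_of_coreLaws`: off `P` the identity reads `2 m(π) = 0`).  The
shape of the `(Pk, hA, hL, hMemLaw)` inputs of ★ `xiRigiditySharpQsAt_of_memLaw_of_pins`. [cite: Rogawski1990, §13.10 pp. 230–231; Thm 13.3.7 p. 203] -/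
theorem mem_aPacket_of_m_ne_zero_of_coreLaws {TGt TG TH : Type} (𝔨 : TwistedComparisonData TGt TG TH)
    (h0 : 𝔨.MainEquality) (hT : 𝔨.MatchTensor) (hE : 𝔨.GermExpansion) (hS : 𝔨.Separation) (hCE : 𝔨.CoeffEndoscopic)
    (hAL : 𝔨.APacketLift) (hLI : 𝔨.LinIndepGerm)
    (ξ : 𝔨.𝔊.PacketH) (h1 : 𝔨.IsOneDimH ξ) (hnt : ¬ 𝔨.𝔊.IsTheta ξ) :
    ∃ P : 𝔨.𝔊.Packet, 𝔨.𝔊.IsAPacket P ∧ 𝔨.𝔊.liftsTo ξ P ∧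
      ∀ π : 𝔨.𝔊.Rep, 𝔨.germRep π = 𝔨.germI ξ → 𝔨.𝔊.m π ≠ 0 → 𝔨.𝔊.mem π P := by
  obtain ⟨P, hA, hL, -, hm⟩ := aPacketMult_of_coreLaws 𝔨 h0 hT hE hS hCE hAL hLI ξ h1 hnt
  refine ⟨P, hA, hL, fun π hg hπ => ?_⟩
  by_contra hmem
  have h2 := hm ⟨π, hg⟩
  rw [if_neg hmem] at h2
  have h0' : (𝔨.𝔊.m π : ℂ) = 0 := by
    have : (2 : ℂ) * (𝔨.𝔊.m π : ℂ) = 0 := h2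
    exact (mul_eq_zero.mp this).resolve_left two_ne_zero
  exact hπ (by exact_mod_cast h0')

end Summit.HodgeConjecture.HodgeConjecture.R90.S5

end
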